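import Summits.QuantumFields.YangMills.Theorems.UnitScaleTiltProp7TransverseRowOfQTwSTubeComparison
import Summits.QuantumFields.YangMills.Theorems.UnitScaleTiltProp7PureGaugeCurlCurvature
import Summits.QuantumFields.YangMills.Theorems.UnitScaleTiltProp7DivSliceOfMemberDivSq
import Summits.QuantumFields.YangMills.Theorems.UnitScaleTiltProp7EngOfTrueAvgBudget
import Summits.QuantumFields.YangMills.Theorems.UnitScaleTiltProp7RieszTauFrobNormT3
import Summits.QuantumFields.YangMills.Theorems.UnitScaleTiltProp7SectET3CurvedPropagatorsT3
import HarnessLib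

/-!
# Route `UnitScaleTilt`, crux «MinimiserStabilityRegPr» (stmt-QuantumFields-19200), stub `stub_existenceMinimalOrbit` (EX), positivity block behind `Lift` —
# pen (b) of `LOCATE-GAMMA-ROW-p1g22.md` §3, FILE 3: **THE TRANSVERSE ROW (T) OF THE γ-ROW DOORS IN THEIR OWN `L²` CURRENCY, AT A PRINTED-REGULAR BACKGROUND,
# MODULO THE ONE DISPLAYED TUBE-COMPARISON ROW `hQcmp`** — ★p1 g23's `hT` binder of ✓`Prop7GaugeFixedFloorSchurDoor.gaugeFixedFloor_of_TGX`∕✓`Prop7GaugeFixedFloorDefectDoor…`: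
# `∀ Y, D*_{U₀}Y = 0 → cT·‖Y‖² ≤ re⟪Y, Δ^η(U₀)Y⟫ + a·‖Q_k(U₀)Y‖²` with EXPLICIT `cT = (1 − 16Cq·ε₀² − 37044ε₀)∕36`, `a = (16∕9)(c₀∕cB)ℓ^d`.

Cell `ym3-torus`, twin-width seat `ym-ust-19200-w7` (gen 10).  THEOREMS ONLY (0 `def`, 0 `sorry`); `--supports stmt-QuantumFields-19200 --as helper`, count-neutral.
YM₃ on T³ is ladder rung R3 — NOT d = 4, NOT infinite volume, NOT a mass gap, NOT Clay; nothing here claims the γ-row, a print row, the stub or the crux.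

THE KNIT (all by name, one displayed row).  For `Y` with `DstarL2 U₀ Y = 0` put `X := toL2⁻¹Y`.  (1) ✓p740688 `…TransverseRowOfQTwSTubeComparison.sum_normSq_le_curl_sq_add_divB_sq_add_QTwS_of_tubeRow`
(the engine ✓`Prop7CovariantCoercivity.sum_normSq_le_curl_sq_add_divB_sq_add_avg_T3` + `hQcmp`): `(1 − 16Cqε₀²)ℓ⁻²Σ_b‖X_b‖² ≤ 18(CURL + DIV) + 32·w·(ℓ^d)²·Σ_{c'}‖QTwS U₀ X c'‖²`,
the plaquette hypothesis from `RegPr` (`regThreshold = ε₀ℓ⁻²`); (2) `DIV = c₀⁻¹ℓ⁻²‖DstarL2 U₀ Y‖² = 0` (✓`Prop7DivSliceOfMemberDivSq.sum_normSq_divB_eq`); (3) `CURL` = the positive-plaquette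
Frobenius sum of ✓`Prop7PureGaugeCurlCurvature.principal_two_sided_of_regPr` (§1 re-indexing), whence `c₀ℓ²·CURL ≤ re⟪Y, Δ^ηY⟫ + 1029ε₀‖Y‖²` ([Balaban1985BackgroundPropagators] (3.10),
★w4∕★p1 g22); (4) `‖Y‖² ≤ 2c₀Σ_b‖X_b‖²` (✓`Prop7SigmaRowsNorm.norm_sq_toL2_le_two_mul`) and `cB·ℓ⁻²·Σ_{c'}‖QTwS X c'‖² ≤ ‖Q_kY‖²` (`Qk = η • toL2B ∘ QTwS ∘ toL2⁻¹`,
✓`Prop7EngOfTrueAvgBudget.norm_toL2B_sq`, op ≤ Frobenius ✓`Prop7RieszTauFrobNorm.norm_le_norm_frobEquiv_symm`, `η² = ℓ⁻²`); (5) arithmetic, the weight identity `2c₀ℓ²·32w(ℓ^d)² = 64(c₀∕cB)ℓ^d·cBℓ⁻²`.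
HONEST SCOPE.  Bookkeeping over landed estimates; the displayed row `hQcmp` (pen (b1): the curved transport comparison) is asserted for nothing — at `U₀ = 1` it is
✓`Prop7TubeComparisonRowFlat.tubeRow_one`.  Nothing of print is claimed beyond the cited tree theorems.
References: T. Bałaban, CMP 99 (1985) 389–434 [Balaban1985BackgroundPropagators] (Thm 3.11 p.416, (3.10) p.392, (3.14)–(3.15) p.393, (3.118)–(3.122) pp.419–420); CMP 95 (1984)
17–40 [Balaban1984PropagatorsI] ((1.18) p.20).
-/

set_option autoImplicit false

noncomputable section

open scoped BigOperators Matrix.Norms.L2Operator Matrix InnerProductSpace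

namespace Summit.QuantumFields.YangMills.Theorems.Prop7TransverseRowOfTubeRowRegPr

open Literature.MathematicalPhysics.QuantumFieldTheory.Balaban1983to89
open Finset B1RG242Torus
open B7Prop1Explicit (treeWord)
open B7Eq78Linearization (conjR)
open B9Eq39Adjoint (curl divB posPlaq)
open B10Eq27TorusAxialLog (holT unitsField toUField)
open B9TorusCalculus (torusT)
open B11Eq103H1Complex (BondL2K)
open T3ContinuumYM3Torus (T3Family)
open T3SectALandauChart (bgUnits formComp eta eta_pos)
open T3PrintedRegularMinimiser (RegPr)
open T3RegularMinimiser (regThreshold)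
open Summit.QuantumFields.YangMills.Theorems.Prop7SectET3Transport (periodsT3)
open Summit.QuantumFields.YangMills.Theorems.Prop7SectET3HilbertLetters (W₂ toL2 toL2B DstarL2 frobEquiv QL2)
open Summit.QuantumFields.YangMills.Theorems.Prop7SectET3WilsonHessian (DeltaEta)
open Summit.QuantumFields.YangMills.Theorems.Prop7SectET3CurvedPropagators (Qk)
open Summit.QuantumFields.YangMills.Theorems.Prop7SymAvgTwSym (QTwS)
open Summit.QuantumFields.YangMills.Theorems.Prop7TransverseRowOfQTwSTubeComparison (sum_normSq_le_curl_sq_add_divB_sq_add_QTwS_of_tubeRow)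
open Summit.QuantumFields.YangMills.Theorems.Prop7PureGaugeCurlCurvature (principal_two_sided_of_regPr)
open Summit.QuantumFields.YangMills.Theorems.Prop7DivSliceOfMemberDivSq (sum_normSq_divB_eq inv_eta_sq_eq eta_sq_eq)
open Summit.QuantumFields.YangMills.Theorems.Prop7SigmaRowsNorm (norm_sq_toL2_le_two_mul)
open Summit.QuantumFields.YangMills.Theorems.Prop7EngOfTrueAvgBudget (norm_toL2B_sq)
open Summit.QuantumFields.YangMills.Theorems.Prop7RieszTauFrobNorm (norm_le_norm_frobEquiv_symm norm_sq_frobEquiv_symm)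

variable (F : T3Family) (n K : ℕ)

/-! ## §1 Dictionary rows -/

/-- **THE ENGINE's CURL SUM IS THE POSITIVE-PLAQUETTE FROBENIUS SUM** of ✓`Prop7PureGaugeCurlCurvature.principal_two_sided_of_regPr` (entrywise squares = Frobenius², `μ < ν` ⇔ `posPlaq`,
`bgUnits = unitsField ∘ toUField`, `formComp X ν x = X ⟨x, ν⟩`). [cite: Balaban1985BackgroundPropagators, (3.10) p.392] -/
theorem curlSum_eq_posPlaq (U₀ : GaugeField (F.P K) 0 (Matrix.specialUnitaryGroup (Fin 2) ℂ)) (X : PBond (F.P K) 0 → Matrix (Fin 2) (Fin 2) ℂ) :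
    (∑ x : Site (F.P K) 0, ∑ μ : Fin (F.P K).d, ∑ ν : Fin (F.P K).d,
        (if μ < ν then ∑ j : Fin 2, ∑ k : Fin 2,
          ‖(curl (torusT (F.P K) 0) (fun κ z => unitsField (toUField U₀) ⟨z, κ⟩) (fun κ z => X ⟨z, κ⟩) μ ν x) j k‖ ^ 2 else 0))
      = ∑ q ∈ posPlaq (Site (F.P K) 0) (Fin (F.P K).d),
          ‖(frobEquiv.symm (curl (torusT (F.P K) 0) (fun μ z => bgUnits F K U₀ ⟨z, μ⟩) (formComp X) q.2.1 q.2.2 q.1) : W₂)‖ ^ 2 := by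
  classical
  unfold B9Eq39Adjoint.posPlaq
  rw [Finset.sum_filter, Fintype.sum_prod_type]
  refine Finset.sum_congr rfl fun x _ => ?_
  rw [Fintype.sum_prod_type]
  refine Finset.sum_congr rfl fun μ _ => Finset.sum_congr rfl fun ν _ => ?_
  split_ifs with hμν
  · rw [norm_sq_frobEquiv_symm]; rfl
  · rfl

/-- The tree's regularity threshold IS the engine's plaquette scale: `regThreshold F n K ε₀ = ε₀·(L^{K−n})⁻²`. [cite: Balaban1985Variational, (2) p.278] -/
theorem regThreshold_eq (ε₀ : ℝ) : regThreshold F n K ε₀ = ε₀ * (((F.L : ℝ) ^ (K - n)) ^ 2)⁻¹ := by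
  simp only [T3RegularMinimiser.regThreshold]
  rw [inv_pow, mul_comm 2 (K - n), pow_mul]

variable (h : n ≤ K) (c₀ cB : ℝ) [Fact (0 < c₀)] [Fact (0 < cB)]

omit [Fact (0 < c₀)] [Fact (0 < cB)] in
/-- **`Q_k` ON THE ROUTE CARRIERS**: `Qk U₀ (toL2 X) = η • toL2B (QTwS U₀ X)` (`Qk := η • QL2`, `QL2 := toL2B ∘ QTwS ∘ toL2⁻¹`). [cite: Balaban1985BackgroundPropagators, (3.14)-(3.15) p.393] -/
theorem Qk_toL2 (U₀ : GaugeField (F.P K) 0 (Matrix.specialUnitaryGroup (Fin 2) ℂ)) (X : PBond (F.P K) 0 → Matrix (Fin 2) (Fin 2) ℂ) :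
    Qk F n K h c₀ cB U₀ (toL2 F K c₀ X) = ((eta F n K : ℝ) : ℂ) • toL2B F n cB (QTwS F n K h U₀ X) := by
  simp only [Prop7SectET3CurvedPropagators.Qk, Prop7SectET3HilbertLetters.QL2, LinearMap.smul_apply, LinearMap.coe_comp, Function.comp_apply,
    LinearEquiv.coe_coe, ContinuousLinearMap.coe_coe, LinearEquiv.symm_apply_apply]

omit [Fact (0 < c₀)] in
/-- **THE AVERAGING TERM, OPERATOR NORMS → `Q_k`**: `cB·ℓ⁻²·Σ_{c'}‖QTwS U₀ X c'‖² ≤ ‖Qk U₀ (toL2 X)‖²` (op ≤ Frobenius bondwise, `η² = ℓ⁻²`).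
[cite: Balaban1985BackgroundPropagators, (3.14)-(3.15) p.393] -/
theorem sum_normSq_QTwS_le_norm_Qk (U₀ : GaugeField (F.P K) 0 (Matrix.specialUnitaryGroup (Fin 2) ℂ)) (X : PBond (F.P K) 0 → Matrix (Fin 2) (Fin 2) ℂ) :
    cB * (((F.L : ℝ) ^ (K - n)) ^ 2)⁻¹ * ∑ c : PBond (F.P n) 0, ‖QTwS F n K h U₀ X c‖ ^ 2 ≤ ‖Qk F n K h c₀ cB U₀ (toL2 F K c₀ X)‖ ^ 2 := by
  have hcB : 0 < cB := Fact.out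
  have hη : 0 < eta F n K := eta_pos F n K
  have hQ : ‖Qk F n K h c₀ cB U₀ (toL2 F K c₀ X)‖ ^ 2
      = (((F.L : ℝ) ^ (K - n)) ^ 2)⁻¹ * (cB * ∑ c : PBond (F.P n) 0, ‖(frobEquiv.symm (QTwS F n K h U₀ X c) : W₂)‖ ^ 2) := by
    rw [Qk_toL2, norm_smul, mul_pow, Complex.norm_real, Real.norm_of_nonneg hη.le, norm_toL2B_sq, eta_sq_eq]
  rw [hQ, ← mul_assoc, mul_comm (cB) _]
  refine mul_le_mul_of_nonneg_left (Finset.sum_le_sum fun c _ => ?_) (by positivity)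
  exact pow_le_pow_left₀ (norm_nonneg _) (norm_le_norm_frobEquiv_symm _) 2

/-! ## §2 The transverse row (T) at a printed-regular background, modulo `hQcmp` -/

set_option maxHeartbeats 400000 in
-- HEARTBEAT rule (README): the knit rewrites the engine's 300-token averaging∕curl∕divergence sums inside one hypothesis and closes by `field_simp`∕`linarith`;
-- measured > 100k at the farm default path, so the budget is made explicit and decl-local.
/-- ★★★ **(T) IN THE γ-ROW DOORS' CURRENCY, MODULO THE TUBE-COMPARISON ROW**: for `RegPr F n K ε₀ U₀`, `216ε₀ ≤ 1`, the window `16Cq·ε₀² ≤ 1`, and the displayed ℓ²-row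
`hQcmp` (✓p740688's binder, at this `U₀`, for every fine bond field), every `Y` with `DstarL2 U₀ Y = 0` satisfies
`(1 − 16Cqε₀² − 37044ε₀)·‖Y‖² ≤ 36·re⟪Y, DeltaEta U₀ Y⟫ + 64(c₀∕cB)(L^{K−n})^d·‖Qk U₀ Y‖²`.
[cite: Balaban1985BackgroundPropagators, Thm 3.11 p.416, (3.10) p.392, (3.118)-(3.122) pp.419-420] -/
theorem transverseRow_of_tubeRow {ε₀ : ℝ} (hε₀ : 0 ≤ ε₀) (hε1 : 216 * ε₀ ≤ 1)
    (U₀ : GaugeField (F.P K) 0 (Matrix.specialUnitaryGroup (Fin 2) ℂ)) (hreg : RegPr F n K ε₀ U₀)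
    {Cq : ℝ} (hwin : 16 * Cq * ε₀ ^ 2 ≤ 1)
    -- THE DISPLAYED ROW (pen (b1)), at this background, for every fine bond field
    (hQcmp : ∀ X : PBond (F.P K) 0 → Matrix (Fin 2) (Fin 2) ℂ,
      ∑ c : PBond (F.P K) (K - n), ‖∑ r : Fin (F.P K).d → Fin ((F.P K).L ^ (K - n)), ∑ t ∈ range ((F.P K).L ^ (K - n)),
        conjR (holT (unitsField (toUField U₀)) (Site.fibreSite 0 (K - n) c.src fun _ => ⟨0, pow_pos (F.P K).L_pos (K - n)⟩)
              (treeWord fun ν => ((r ν : ℕ) : ℤ))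
            * holT (unitsField (toUField U₀)) (Site.fibreSite 0 (K - n) c.src r) (List.replicate t (c.dir, true)))
          (X ⟨(fun z : Site (F.P K) 0 => z.shift c.dir)^[t] (Site.fibreSite 0 (K - n) c.src r), c.dir⟩)‖ ^ 2
      ≤ 2 * (((F.L : ℝ) ^ (K - n)) ^ (F.P K).d) ^ 2 * ∑ c' : PBond (F.P n) 0, ‖QTwS F n K h U₀ X c'‖ ^ 2
        + Cq * ε₀ ^ 2 * (((F.L : ℝ) ^ (K - n)) ^ (F.P K).d * ((F.L : ℝ) ^ (K - n)) ^ 2) * ∑ b : PBond (F.P K) 0, ‖X b‖ ^ 2)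
    (Y : BondL2K ℂ 3 (periodsT3 F K) c₀ W₂) (hY : DstarL2 F n K c₀ U₀ Y = 0) :
    (1 - 16 * Cq * ε₀ ^ 2 - 37044 * ε₀) * ‖Y‖ ^ 2
      ≤ 36 * RCLike.re ⟪Y, DeltaEta F n K c₀ U₀ Y⟫_ℂ
        + 64 * (c₀ / cB) * ((F.L : ℝ) ^ (K - n)) ^ (F.P K).d * ‖Qk F n K h c₀ cB U₀ Y‖ ^ 2 := by
  classical
  have hc₀ : 0 < c₀ := Fact.out
  have hcB : 0 < cB := Fact.out
  have hLpos : (0 : ℝ) < (F.L : ℝ) ^ (K - n) := by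
    have : (0 : ℝ) < F.L := by have := F.hL.2; exact_mod_cast (by omega : 0 < F.L)
    positivity
  -- the fine-lattice representative
  set X : PBond (F.P K) 0 → Matrix (Fin 2) (Fin 2) ℂ := (toL2 F K c₀).symm Y with hXdef
  have hYX : toL2 F K c₀ X = Y := (toL2 F K c₀).apply_symm_apply Y
  -- (1) the engine door with the displayed row, plaquette hypothesis from `RegPr`
  have hU : ∀ p : Plaq (F.P K) 0, dist1 (GaugeField.plaqHol U₀ p) ≤ ε₀ * (((F.L : ℝ) ^ (K - n)) ^ 2)⁻¹ := fun p => by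
    have hp := hreg.plaqSmall p
    rw [regThreshold_eq] at hp
    exact hp.le
  have hE := sum_normSq_le_curl_sq_add_divB_sq_add_QTwS_of_tubeRow F n K h U₀ hε₀ hε1 hU X Cq (hQcmp X)
  -- (2) the divergence term vanishes, (3) the curl term is the principal part's plaquette sum
  have hD : ∑ x : Site (F.P K) 0, ∑ j : Fin 2, ∑ k : Fin 2,
      ‖(divB (torusT (F.P K) 0) (fun κ z => unitsField (toUField U₀) ⟨z, κ⟩) (fun κ z => X ⟨z, κ⟩) x) j k‖ ^ 2 = 0 := by
    rw [sum_normSq_divB_eq F n K c₀ U₀ X, hYX, hY, norm_zero]; simp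
  rw [hD, add_zero, curlSum_eq_posPlaq F K U₀ X] at hE
  have hP := (principal_two_sided_of_regPr (n := n) (c₀ := c₀) hε₀ U₀ hreg X).1
  rw [inv_eta_sq_eq, hYX] at hP
  -- (4) norms
  have hN := norm_sq_toL2_le_two_mul F K c₀ X
  rw [hYX] at hN
  have hQ := sum_normSq_QTwS_le_norm_Qk F n K h c₀ cB U₀ X
  rw [hYX] at hQ
  -- (5) arithmetic over the letters
  set l2 : ℝ := ((F.L : ℝ) ^ (K - n)) ^ 2 with hl2
  set ld : ℝ := ((F.L : ℝ) ^ (K - n)) ^ (F.P K).d with hld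
  set S : ℝ := ∑ b : PBond (F.P K) 0, ‖X b‖ ^ 2 with hS
  set SP : ℝ := ∑ q ∈ posPlaq (Site (F.P K) 0) (Fin (F.P K).d),
      ‖(frobEquiv.symm (curl (torusT (F.P K) 0) (fun μ z => bgUnits F K U₀ ⟨z, μ⟩) (formComp X) q.2.1 q.2.2 q.1) : W₂)‖ ^ 2 with hSP
  set Q : ℝ := ∑ c' : PBond (F.P n) 0, ‖QTwS F n K h U₀ X c'‖ ^ 2 with hQdef
  set NY : ℝ := ‖Y‖ ^ 2 with hNY
  set NQ : ℝ := ‖Qk F n K h c₀ cB U₀ Y‖ ^ 2 with hNQ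
  set RE : ℝ := RCLike.re ⟪Y, DeltaEta F n K c₀ U₀ Y⟫_ℂ with hRE
  have hl2pos : 0 < l2 := by rw [hl2]; positivity
  have hldpos : 0 < ld := by rw [hld]; positivity
  have hSnn : 0 ≤ S := by rw [hS]; positivity
  have hQnn : 0 ≤ Q := by rw [hQdef]; positivity
  have hw0 : 0 ≤ 1 - 16 * Cq * ε₀ ^ 2 := by linarith
  -- h1: the `L²` norm against the fine sum
  have h1 : (1 - 16 * Cq * ε₀ ^ 2) * NY ≤ (1 - 16 * Cq * ε₀ ^ 2) * (2 * c₀ * S) := mul_le_mul_of_nonneg_left hN hw0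
  -- h3: the engine door scaled by `2c₀ℓ²`
  have h3 : 2 * c₀ * l2 * ((1 - 16 * Cq * ε₀ ^ 2) * (l2⁻¹ * S))
      ≤ 2 * c₀ * l2 * (18 * SP + 32 * ((ld * l2)⁻¹ * l2⁻¹) * ld ^ 2 * Q) := by
    refine mul_le_mul_of_nonneg_left ?_ (by positivity)
    simpa only [mul_zero, add_zero] using hE
  have h2 : (1 - 16 * Cq * ε₀ ^ 2) * (2 * c₀ * S) = 2 * c₀ * l2 * ((1 - 16 * Cq * ε₀ ^ 2) * (l2⁻¹ * S)) := by
    field_simp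
  have h4 : 2 * c₀ * l2 * (18 * SP + 32 * ((ld * l2)⁻¹ * l2⁻¹) * ld ^ 2 * Q)
      = 36 * (c₀ * l2 * SP) + 64 * (c₀ / cB) * ld * (cB * l2⁻¹ * Q) := by
    field_simp
    ring
  -- h5: the principal part; h7: the averaging term
  have h5 : c₀ * l2 * SP ≤ RE + 1029 * ε₀ * NY := by rw [hRE, hNY, hSP, hl2]; linarith [hP]
  have h7 : 64 * (c₀ / cB) * ld * (cB * l2⁻¹ * Q) ≤ 64 * (c₀ / cB) * ld * NQ :=
    mul_le_mul_of_nonneg_left (by rw [hNQ, hQdef, hl2]; exact hQ) (by positivity)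
  linarith [h1, h2, h3, h4, h5, h7]

/-- ★★ **(T) AS ★p1 g23's `hT` BINDER** (`cT·‖Y‖² ≤ re⟪Y, Δ^ηY⟫ + a·‖Q_kY‖²` on `D*Y = 0`) with `cT := (1 − 16Cqε₀² − 37044ε₀)∕36` and `a := (16∕9)(c₀∕cB)(L^{K−n})^d`,
modulo `hQcmp`. [cite: Balaban1985BackgroundPropagators, Thm 3.11 p.416, (3.118)-(3.122) pp.419-420] -/
theorem hT_of_tubeRow {ε₀ : ℝ} (hε₀ : 0 ≤ ε₀) (hε1 : 216 * ε₀ ≤ 1)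
    (U₀ : GaugeField (F.P K) 0 (Matrix.specialUnitaryGroup (Fin 2) ℂ)) (hreg : RegPr F n K ε₀ U₀)
    {Cq : ℝ} (hwin : 16 * Cq * ε₀ ^ 2 ≤ 1)
    (hQcmp : ∀ X : PBond (F.P K) 0 → Matrix (Fin 2) (Fin 2) ℂ,
      ∑ c : PBond (F.P K) (K - n), ‖∑ r : Fin (F.P K).d → Fin ((F.P K).L ^ (K - n)), ∑ t ∈ range ((F.P K).L ^ (K - n)),
        conjR (holT (unitsField (toUField U₀)) (Site.fibreSite 0 (K - n) c.src fun _ => ⟨0, pow_pos (F.P K).L_pos (K - n)⟩)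
              (treeWord fun ν => ((r ν : ℕ) : ℤ))
            * holT (unitsField (toUField U₀)) (Site.fibreSite 0 (K - n) c.src r) (List.replicate t (c.dir, true)))
          (X ⟨(fun z : Site (F.P K) 0 => z.shift c.dir)^[t] (Site.fibreSite 0 (K - n) c.src r), c.dir⟩)‖ ^ 2
      ≤ 2 * (((F.L : ℝ) ^ (K - n)) ^ (F.P K).d) ^ 2 * ∑ c' : PBond (F.P n) 0, ‖QTwS F n K h U₀ X c'‖ ^ 2
        + Cq * ε₀ ^ 2 * (((F.L : ℝ) ^ (K - n)) ^ (F.P K).d * ((F.L : ℝ) ^ (K - n)) ^ 2) * ∑ b : PBond (F.P K) 0, ‖X b‖ ^ 2) :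
    ∀ Y : BondL2K ℂ 3 (periodsT3 F K) c₀ W₂, DstarL2 F n K c₀ U₀ Y = 0 →
      (1 - 16 * Cq * ε₀ ^ 2 - 37044 * ε₀) / 36 * ‖Y‖ ^ 2
        ≤ RCLike.re ⟪Y, DeltaEta F n K c₀ U₀ Y⟫_ℂ + 16 / 9 * (c₀ / cB) * ((F.L : ℝ) ^ (K - n)) ^ (F.P K).d * ‖Qk F n K h c₀ cB U₀ Y‖ ^ 2 := by
  intro Y hY
  have hmain := transverseRow_of_tubeRow F n K h c₀ cB hε₀ hε1 U₀ hreg hwin hQcmp Y hY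
  linarith

/-! ## §3 v2: free comparison constant `CT` (the located supplier gives `CT = 4`) -/

set_option maxHeartbeats 400000 in
-- HEARTBEAT rule (README): same knit as `transverseRow_of_tubeRow` (measured > 100k); budget explicit and decl-local.
/-- ★★★ **(T) IN THE γ-ROW DOORS' CURRENCY, MODULO THE TUBE-COMPARISON ROW WITH A FREE CONSTANT `CT`** (v2; row =
✓`Prop7TransverseRowOfQTwSTubeComparison.sum_normSq_le_curl_sq_add_divB_sq_add_QTwS_of_tubeRowC`'s binder, `0 ≤ CT`): for `RegPr F n K ε₀ U₀`, `216ε₀ ≤ 1`, `16Cq·ε₀² ≤ 1`,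
every `Y` with `DstarL2 U₀ Y = 0` satisfies `(1 − 16Cqε₀² − 37044ε₀)·‖Y‖² ≤ 36·re⟪Y, DeltaEta U₀ Y⟫ + 32·CT·(c₀∕cB)(L^{K−n})^d·‖Qk U₀ Y‖²`.
[cite: Balaban1985BackgroundPropagators, Thm 3.11 p.416, (3.10) p.392, (3.118)-(3.122) pp.419-420] -/
theorem transverseRow_of_tubeRowC {ε₀ : ℝ} (hε₀ : 0 ≤ ε₀) (hε1 : 216 * ε₀ ≤ 1)
    (U₀ : GaugeField (F.P K) 0 (Matrix.specialUnitaryGroup (Fin 2) ℂ)) (hreg : RegPr F n K ε₀ U₀)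
    {CT Cq : ℝ} (hCT : 0 ≤ CT) (hwin : 16 * Cq * ε₀ ^ 2 ≤ 1)
    (hQcmp : ∀ X : PBond (F.P K) 0 → Matrix (Fin 2) (Fin 2) ℂ,
      ∑ c : PBond (F.P K) (K - n), ‖∑ r : Fin (F.P K).d → Fin ((F.P K).L ^ (K - n)), ∑ t ∈ range ((F.P K).L ^ (K - n)),
        conjR (holT (unitsField (toUField U₀)) (Site.fibreSite 0 (K - n) c.src fun _ => ⟨0, pow_pos (F.P K).L_pos (K - n)⟩)
              (treeWord fun ν => ((r ν : ℕ) : ℤ))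
            * holT (unitsField (toUField U₀)) (Site.fibreSite 0 (K - n) c.src r) (List.replicate t (c.dir, true)))
          (X ⟨(fun z : Site (F.P K) 0 => z.shift c.dir)^[t] (Site.fibreSite 0 (K - n) c.src r), c.dir⟩)‖ ^ 2
      ≤ CT * (((F.L : ℝ) ^ (K - n)) ^ (F.P K).d) ^ 2 * ∑ c' : PBond (F.P n) 0, ‖QTwS F n K h U₀ X c'‖ ^ 2
        + Cq * ε₀ ^ 2 * (((F.L : ℝ) ^ (K - n)) ^ (F.P K).d * ((F.L : ℝ) ^ (K - n)) ^ 2) * ∑ b : PBond (F.P K) 0, ‖X b‖ ^ 2)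
    (Y : BondL2K ℂ 3 (periodsT3 F K) c₀ W₂) (hY : DstarL2 F n K c₀ U₀ Y = 0) :
    (1 - 16 * Cq * ε₀ ^ 2 - 37044 * ε₀) * ‖Y‖ ^ 2
      ≤ 36 * RCLike.re ⟪Y, DeltaEta F n K c₀ U₀ Y⟫_ℂ
        + 32 * CT * (c₀ / cB) * ((F.L : ℝ) ^ (K - n)) ^ (F.P K).d * ‖Qk F n K h c₀ cB U₀ Y‖ ^ 2 := by
  classical
  have hc₀ : 0 < c₀ := Fact.out
  have hcB : 0 < cB := Fact.out
  have hLpos : (0 : ℝ) < (F.L : ℝ) ^ (K - n) := by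
    have : (0 : ℝ) < F.L := by have := F.hL.2; exact_mod_cast (by omega : 0 < F.L)
    positivity
  set X : PBond (F.P K) 0 → Matrix (Fin 2) (Fin 2) ℂ := (toL2 F K c₀).symm Y with hXdef
  have hYX : toL2 F K c₀ X = Y := (toL2 F K c₀).apply_symm_apply Y
  have hU : ∀ p : Plaq (F.P K) 0, dist1 (GaugeField.plaqHol U₀ p) ≤ ε₀ * (((F.L : ℝ) ^ (K - n)) ^ 2)⁻¹ := fun p => by
    have hp := hreg.plaqSmall p
    rw [regThreshold_eq] at hp
    exact hp.le
  have hE := Prop7TransverseRowOfQTwSTubeComparison.sum_normSq_le_curl_sq_add_divB_sq_add_QTwS_of_tubeRowC F n K h U₀ hε₀ hε1 hU X CT Cq (hQcmp X)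
  have hD : ∑ x : Site (F.P K) 0, ∑ j : Fin 2, ∑ k : Fin 2,
      ‖(divB (torusT (F.P K) 0) (fun κ z => unitsField (toUField U₀) ⟨z, κ⟩) (fun κ z => X ⟨z, κ⟩) x) j k‖ ^ 2 = 0 := by
    rw [sum_normSq_divB_eq F n K c₀ U₀ X, hYX, hY, norm_zero]; simp
  rw [hD, add_zero, curlSum_eq_posPlaq F K U₀ X] at hE
  have hP := (principal_two_sided_of_regPr (n := n) (c₀ := c₀) hε₀ U₀ hreg X).1
  rw [inv_eta_sq_eq, hYX] at hP
  have hN := norm_sq_toL2_le_two_mul F K c₀ X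
  rw [hYX] at hN
  have hQ := sum_normSq_QTwS_le_norm_Qk F n K h c₀ cB U₀ X
  rw [hYX] at hQ
  set l2 : ℝ := ((F.L : ℝ) ^ (K - n)) ^ 2 with hl2
  set ld : ℝ := ((F.L : ℝ) ^ (K - n)) ^ (F.P K).d with hld
  set S : ℝ := ∑ b : PBond (F.P K) 0, ‖X b‖ ^ 2 with hS
  set SP : ℝ := ∑ q ∈ posPlaq (Site (F.P K) 0) (Fin (F.P K).d),
      ‖(frobEquiv.symm (curl (torusT (F.P K) 0) (fun μ z => bgUnits F K U₀ ⟨z, μ⟩) (formComp X) q.2.1 q.2.2 q.1) : W₂)‖ ^ 2 with hSP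
  set Q : ℝ := ∑ c' : PBond (F.P n) 0, ‖QTwS F n K h U₀ X c'‖ ^ 2 with hQdef
  set NY : ℝ := ‖Y‖ ^ 2 with hNY
  set NQ : ℝ := ‖Qk F n K h c₀ cB U₀ Y‖ ^ 2 with hNQ
  set RE : ℝ := RCLike.re ⟪Y, DeltaEta F n K c₀ U₀ Y⟫_ℂ with hRE
  have hl2pos : 0 < l2 := by rw [hl2]; positivity
  have hldpos : 0 < ld := by rw [hld]; positivity
  have hSnn : 0 ≤ S := by rw [hS]; positivity
  have hQnn : 0 ≤ Q := by rw [hQdef]; positivity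
  have hw0 : 0 ≤ 1 - 16 * Cq * ε₀ ^ 2 := by linarith
  have h1 : (1 - 16 * Cq * ε₀ ^ 2) * NY ≤ (1 - 16 * Cq * ε₀ ^ 2) * (2 * c₀ * S) := mul_le_mul_of_nonneg_left hN hw0
  have h3 : 2 * c₀ * l2 * ((1 - 16 * Cq * ε₀ ^ 2) * (l2⁻¹ * S))
      ≤ 2 * c₀ * l2 * (18 * SP + 16 * CT * ((ld * l2)⁻¹ * l2⁻¹) * ld ^ 2 * Q) := by
    refine mul_le_mul_of_nonneg_left ?_ (by positivity)
    simpa only [mul_zero, add_zero] using hE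
  have h2 : (1 - 16 * Cq * ε₀ ^ 2) * (2 * c₀ * S) = 2 * c₀ * l2 * ((1 - 16 * Cq * ε₀ ^ 2) * (l2⁻¹ * S)) := by
    field_simp
  have h4 : 2 * c₀ * l2 * (18 * SP + 16 * CT * ((ld * l2)⁻¹ * l2⁻¹) * ld ^ 2 * Q)
      = 36 * (c₀ * l2 * SP) + 32 * CT * (c₀ / cB) * ld * (cB * l2⁻¹ * Q) := by
    field_simp
    ring
  have h5 : c₀ * l2 * SP ≤ RE + 1029 * ε₀ * NY := by rw [hRE, hNY, hSP, hl2]; linarith [hP]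
  have h7 : 32 * CT * (c₀ / cB) * ld * (cB * l2⁻¹ * Q) ≤ 32 * CT * (c₀ / cB) * ld * NQ :=
    mul_le_mul_of_nonneg_left (by rw [hNQ, hQdef, hl2]; exact hQ) (by positivity)
  linarith [h1, h2, h3, h4, h5, h7]

/-- ★★ **(T) AS THE `hT` BINDER WITH A FREE `CT`** (v2): `cT := (1 − 16Cqε₀² − 37044ε₀)∕36`, `a := (8∕9)·CT·(c₀∕cB)(L^{K−n})^d`, modulo the `CT`-row.
[cite: Balaban1985BackgroundPropagators, Thm 3.11 p.416, (3.118)-(3.122) pp.419-420] -/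
theorem hT_of_tubeRowC {ε₀ : ℝ} (hε₀ : 0 ≤ ε₀) (hε1 : 216 * ε₀ ≤ 1)
    (U₀ : GaugeField (F.P K) 0 (Matrix.specialUnitaryGroup (Fin 2) ℂ)) (hreg : RegPr F n K ε₀ U₀)
    {CT Cq : ℝ} (hCT : 0 ≤ CT) (hwin : 16 * Cq * ε₀ ^ 2 ≤ 1)
    (hQcmp : ∀ X : PBond (F.P K) 0 → Matrix (Fin 2) (Fin 2) ℂ,
      ∑ c : PBond (F.P K) (K - n), ‖∑ r : Fin (F.P K).d → Fin ((F.P K).L ^ (K - n)), ∑ t ∈ range ((F.P K).L ^ (K - n)),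
        conjR (holT (unitsField (toUField U₀)) (Site.fibreSite 0 (K - n) c.src fun _ => ⟨0, pow_pos (F.P K).L_pos (K - n)⟩)
              (treeWord fun ν => ((r ν : ℕ) : ℤ))
            * holT (unitsField (toUField U₀)) (Site.fibreSite 0 (K - n) c.src r) (List.replicate t (c.dir, true)))
          (X ⟨(fun z : Site (F.P K) 0 => z.shift c.dir)^[t] (Site.fibreSite 0 (K - n) c.src r), c.dir⟩)‖ ^ 2
      ≤ CT * (((F.L : ℝ) ^ (K - n)) ^ (F.P K).d) ^ 2 * ∑ c' : PBond (F.P n) 0, ‖QTwS F n K h U₀ X c'‖ ^ 2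
        + Cq * ε₀ ^ 2 * (((F.L : ℝ) ^ (K - n)) ^ (F.P K).d * ((F.L : ℝ) ^ (K - n)) ^ 2) * ∑ b : PBond (F.P K) 0, ‖X b‖ ^ 2) :
    ∀ Y : BondL2K ℂ 3 (periodsT3 F K) c₀ W₂, DstarL2 F n K c₀ U₀ Y = 0 →
      (1 - 16 * Cq * ε₀ ^ 2 - 37044 * ε₀) / 36 * ‖Y‖ ^ 2
        ≤ RCLike.re ⟪Y, DeltaEta F n K c₀ U₀ Y⟫_ℂ + 8 / 9 * CT * (c₀ / cB) * ((F.L : ℝ) ^ (K - n)) ^ (F.P K).d * ‖Qk F n K h c₀ cB U₀ Y‖ ^ 2 := by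
  intro Y hY
  have hmain := transverseRow_of_tubeRowC F n K h c₀ cB hε₀ hε1 U₀ hreg hCT hwin hQcmp Y hY
  linarith

end Summit.QuantumFields.YangMills.Theorems.Prop7TransverseRowOfTubeRowRegPr

end
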